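import Literature.Analysis.Calculus.ResolutionChartWeights
import Literature.Analysis.Calculus.RealAnalyticZeroSetProofs
import HarnessLib

/-!
# Change of variables along a resolution of singularities: the chart sum

Given the output of Hironaka's (simultaneous, embedded, real-analytic) resolution of singularities
at the origin of `ℝ^d` in the form printed by Watanabe (2009, Thm. 2.8) / Lin (2017, Thm. 2.2 and
Cor. 2.3) / Arnold–Gusein-Zade–Varchenko II (Part II §6.3 Thm. 6.6, one function) — a real-analytic
manifold `M`, a real-analytic `g : M → W ⊆ ℝ^d` proper over the open `W ∋ 0`, bijective off the
zero sets of the `F_i`, and at every point of the zero set an analytic chart in which every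
`F_i ∘ g` is a unit times a monomial and the Jacobian determinant of `g` is a unit times a monomial —
this file PROVES the first step of every use of it for integrals (AGV II, proof of Thm. 7.5:
"make the change of variables with `π`, then a sufficiently fine partition of unity turns the
integral into a sum of elementary integrals"; Lin 2017, proof of Lemma 2.4): there are a cube
`‖z‖ < r` around `0` and finitely many continuous chart maps `Π_n` (the resolution map read in the
`n`-th chart, clamped to its closed cube `‖u‖ ≤ δ_n`) with

  `∫ G = ∑_n ∫_{‖u‖ < δ_n} G(Π_n u) · ω_n(u) · J_n(u) · ∏_j |u_j|^{h_{n,j}} du`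

for every bounded measurable `G` supported in the cube `‖z‖ < r`, where `ω_n ≥ 0` are continuous
weights positive at the chart centres, `J_n > 0` continuous (the Jacobian unit), and
`F_i (Π_n u) = A_{n,i}(u) u^{k_{n,i}}` on the closed cube with continuous units `A_{n,i} ≠ 0`.
Ingredients: `ResolutionChartWeights` (fibre compactness, weights), Mathlib's change of variables
`integral_image_eq_integral_abs_det_fderiv_smul` chart by chart, null coordinate hyperplanes, and
the tree's theorem that zero sets of non-trivial real-analytic functions are Lebesgue-null
(`Mityagin2015.volume_zeroSet_null_pi`). No definitions, no named facts: the resolution is a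
HYPOTHESIS here (its data are the binders), exactly as printed.

## References

* S. Watanabe, *Algebraic Geometry and Statistical Learning Theory*, CUP (2009), Thm. 2.8
  (simultaneous resolution), Thm. 2.3, Remark 2.12. [WatanabeSumio2009]
* S. Lin, arXiv:1003.5338, Thm. 2.2, Cor. 2.3, proof of Lemma 2.4. [Lin2017]
* V. I. Arnold, S. M. Gusein-Zade, A. N. Varchenko, *Singularities of Differentiable Maps II*
  (2012), Part II §6.3 Thm. 6.6 and §7.3, proof of Thm. 7.5. [ArnoldGuseinzadeVarchenko2012]
-/

noncomputable section

open Set Filter Metric Function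
open _root_.MeasureTheory _root_.Topology
open scoped ContDiff Manifold

namespace Literature.Analysis.Calculus

namespace Resolution

variable {d : ℕ}

/-! ## Null coordinate hyperplanes -/

/-- The union of the coordinate hyperplanes of `ℝ^d` is Lebesgue-null. [folklore] -/
theorem volume_iUnion_coord_eq_zero :
    volume (⋃ j : Fin d, {u : Fin d → ℝ | u j = 0}) = 0 := by
  refine measure_iUnion_null fun j => ?_
  rw [volume_pi]
  exact Measure.pi_hyperplane _ j 0

/-- Extension of a set integral across a set on which the integrand vanishes off the coordinate
hyperplanes. [folklore] -/
theorem setIntegral_eq_of_zero_off_hyperplanes {X : (Fin d → ℝ) → ℝ} {T B : Set (Fin d → ℝ)}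
    (hB : MeasurableSet B) (hTB : T ⊆ B)
    (h : ∀ u ∈ B \ T, X u ≠ 0 → ∃ j, u j = 0) :
    ∫ u in B, X u = ∫ u in T, X u := by
  refine setIntegral_eq_of_subset_of_ae_sdiff_eq_zero hB.nullMeasurableSet hTB ?_
  have hae : ∀ᵐ u : Fin d → ℝ, u ∉ ⋃ j : Fin d, {u : Fin d → ℝ | u j = 0} :=
    measure_eq_zero_iff_ae_notMem.1 volume_iUnion_coord_eq_zero
  filter_upwards [hae] with u hu huBT
  by_contra hX
  obtain ⟨j, hj⟩ := h u huBT hX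
  exact hu (mem_iUnion.2 ⟨j, hj⟩)

/-! ## Change of variables in one chart -/

/-- **Change of variables in one resolution chart.** `P` analytic on an open `O ⊇ {‖u‖ ≤ δ}`
(the resolution map read in a chart), `Pc` a continuous map agreeing with `P` on the open cube,
injective on `T = {‖u‖ < δ} ∩ Pc⁻¹ S` (`S` open), with `|det P'(u)| = J(u) ∏ |u_j|^{h_j}` on the
open cube: for bounded measurable `G` and continuous `wc`, the image `Pc(T)` is measurable,
`z ↦ G z · wc(Pc|_T⁻¹ z)` is integrable on it, and
`∫_{Pc T} G · (wc ∘ Pc|_T⁻¹) = ∫_T G(Pc u) wc(u) J(u) ∏ |u_j|^{h_j} du`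
(Mathlib's `integral_image_eq_integral_abs_det_fderiv_smul`). [folklore] -/
theorem setIntegral_image_chart {δ : ℝ} {Pc P : (Fin d → ℝ) → (Fin d → ℝ)} {O S : Set (Fin d → ℝ)}
    (hP : AnalyticOnNhd ℝ P O) (hball : closedBall 0 δ ⊆ O)
    (hPcP : ∀ u ∈ ball (0 : Fin d → ℝ) δ, Pc u = P u) (hPc : Continuous Pc) (hS : IsOpen S)
    (hinj : InjOn Pc (ball 0 δ ∩ Pc ⁻¹' S))
    {J : (Fin d → ℝ) → ℝ} {h : Fin d → ℕ} (hJ : Continuous J)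
    (hdet : ∀ u ∈ ball (0 : Fin d → ℝ) δ, |(fderiv ℝ P u).det| = J u * ∏ j, |u j| ^ h j)
    {G : (Fin d → ℝ) → ℝ} (hGm : Measurable G) {C : ℝ} (hGC : ∀ z, |G z| ≤ C)
    {wc : (Fin d → ℝ) → ℝ} (hwc : Continuous wc) :
    MeasurableSet (Pc '' (ball 0 δ ∩ Pc ⁻¹' S)) ∧
    IntegrableOn (fun z => G z * wc (invFunOn Pc (ball 0 δ ∩ Pc ⁻¹' S) z))
      (Pc '' (ball 0 δ ∩ Pc ⁻¹' S)) ∧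
    ∫ z in Pc '' (ball 0 δ ∩ Pc ⁻¹' S), G z * wc (invFunOn Pc (ball 0 δ ∩ Pc ⁻¹' S) z) =
      ∫ u in ball 0 δ ∩ Pc ⁻¹' S, G (Pc u) * (wc u * (J u * ∏ j, |u j| ^ h j)) := by
  set T : Set (Fin d → ℝ) := ball 0 δ ∩ Pc ⁻¹' S with hT
  have hTo : IsOpen T := isOpen_ball.inter (hS.preimage hPc)
  have hTm : MeasurableSet T := hTo.measurableSet
  have hTball : T ⊆ ball 0 δ := inter_subset_left
  -- the derivative of `Pc` on `T`
  have hderiv : ∀ u ∈ T, HasFDerivWithinAt Pc (fderiv ℝ P u) T u := by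
    intro u hu
    have hub : u ∈ ball (0 : Fin d → ℝ) δ := hTball hu
    have hPd : HasFDerivAt P (fderiv ℝ P u) u :=
      ((hP u (hball (ball_subset_closedBall hub))).differentiableAt).hasFDerivAt
    have heq : Pc =ᶠ[𝓝 u] P := eventually_of_mem (isOpen_ball.mem_nhds hub) hPcP
    exact (hPd.congr_of_eventuallyEq heq).hasFDerivWithinAt
  have himage : MeasurableSet (Pc '' T) := measurable_image_of_fderivWithin hTm hderiv hinj
  -- the integrand after the change of variables, in closed form on `T`
  set X : (Fin d → ℝ) → ℝ := fun u => G (Pc u) * (wc u * (J u * ∏ j, |u j| ^ h j)) with hX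
  have hXm : Measurable X := by
    refine (hGm.comp hPc.measurable).mul ((hwc.measurable).mul (hJ.measurable.mul ?_))
    exact (continuous_finsetProd _ fun j _ => (continuous_abs.comp (continuous_apply j)).pow _).measurable
  have hleft : LeftInvOn (invFunOn Pc T) Pc T := hinj.leftInvOn_invFunOn
  have hEqOn : EqOn (fun u => |(fderiv ℝ P u).det| •
      (G (Pc u) * wc (invFunOn Pc T (Pc u)))) X T := by
    intro u hu
    simp only [hX, smul_eq_mul]
    rw [hleft hu, hdet u (hTball hu)]
    ring
  -- boundedness of `X` on `T`
  obtain ⟨B, hB⟩ : ∃ B, ∀ u ∈ closedBall (0 : Fin d → ℝ) δ,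
      ‖wc u * (J u * ∏ j, |u j| ^ h j)‖ ≤ B :=
    (isCompact_closedBall (0 : Fin d → ℝ) δ).exists_bound_of_continuousOn
      ((hwc.mul (hJ.mul (continuous_finsetProd _ fun j _ =>
        (continuous_abs.comp (continuous_apply j)).pow _))).continuousOn)
  have hC0 : 0 ≤ C := le_trans (abs_nonneg _) (hGC 0)
  have hXbound : ∀ u ∈ T, ‖X u‖ ≤ C * B := by
    intro u hu
    have h1 : ‖G (Pc u)‖ ≤ C := by rw [Real.norm_eq_abs]; exact hGC _
    have h2 := hB u (ball_subset_closedBall (hTball hu))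
    calc ‖X u‖ = ‖G (Pc u)‖ * ‖wc u * (J u * ∏ j, |u j| ^ h j)‖ := norm_mul _ _
      _ ≤ C * B := mul_le_mul h1 h2 (norm_nonneg _) hC0
  have hXint : IntegrableOn X T := by
    refine Measure.integrableOn_of_bounded (M := C * B) ?_ hXm.aestronglyMeasurable ?_
    · exact (lt_of_le_of_lt (measure_mono hTball) measure_ball_lt_top).ne
    · exact (ae_restrict_iff' hTm).2 (ae_of_all _ hXbound)
  have hint : IntegrableOn (fun u => |(fderiv ℝ P u).det| •
      (G (Pc u) * wc (invFunOn Pc T (Pc u)))) T :=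
    hXint.congr_fun hEqOn.symm hTm
  refine ⟨himage, ?_, ?_⟩
  · exact (integrableOn_image_iff_integrableOn_abs_det_fderiv_smul volume hTm hderiv hinj _).2
      hint
  · rw [integral_image_eq_integral_abs_det_fderiv_smul volume hTm hderiv hinj]
    exact setIntegral_congr_fun hTm hEqOn

/-! ## Analyticity of the resolution map read in an analytic chart -/

/-- An analytic map `g : M → ℝ^d` read in a chart of the analytic maximal atlas is real-analytic
on the chart target. [folklore] -/
theorem analyticOnNhd_comp_symm {M : Type*} [TopologicalSpace M] [ChartedSpace (Fin d → ℝ) M]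
    [IsManifold 𝓘(ℝ, Fin d → ℝ) ω M] {g : M → (Fin d → ℝ)}
    (hg : ContMDiff 𝓘(ℝ, Fin d → ℝ) 𝓘(ℝ, Fin d → ℝ) ω g)
    {φ : OpenPartialHomeomorph M (Fin d → ℝ)}
    (hφ : φ ∈ IsManifold.maximalAtlas 𝓘(ℝ, Fin d → ℝ) ω M) :
    AnalyticOnNhd ℝ (g ∘ φ.symm) φ.target := by
  have h1 : ContMDiffOn 𝓘(ℝ, Fin d → ℝ) 𝓘(ℝ, Fin d → ℝ) ω φ.symm φ.target :=
    contMDiffOn_symm_of_mem_maximalAtlas hφ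
  have h3 : ContDiffOn ℝ ω (g ∘ φ.symm) φ.target :=
    contMDiffOn_iff_contDiffOn.1 (hg.comp_contMDiffOn h1)
  exact φ.open_target.analyticOn_iff_analyticOnNhd.1
    ((contDiffOn_omega_iff_analyticOn φ.open_target.uniqueDiffOn).1 h3)

/-! ## The chart sum -/

/-- **The chart sum of a resolution of singularities** (AGV II §7.3, proof of Thm. 7.5, first
paragraph; Lin 2017, proof of Lemma 2.4). Hypotheses = the printed output of the simultaneous
resolution of `F_1, …, F_l` at `0 ∈ V ⊆ ℝ^d` (Watanabe 2009 Thm. 2.8; Lin 2017 Thm. 2.2/Cor. 2.3):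
`M` a Hausdorff real-analytic `d`-manifold, `g : M → W` analytic and proper over the open
`W ∋ 0`, `W ⊆ V`, bijective from `{∀ i, F_i ∘ g ≠ 0}` onto `{x ∈ W | ∀ i, F_i x ≠ 0}`, and at every
point of the zero set an analytic chart centred there in which `F_i ∘ g = a_i · u^{k_i}` and
`det (g ∘ φ⁻¹)' = b · u^h` with analytic units `a_i, b`; moreover the `F_i` are analytic and not
identically zero on the preconnected open `V`, and some `F_{i₀}` vanishes at `0`. Conclusion: a
radius `r > 0` (closed cube inside `W`) and finitely many chart data — continuous `Π_n : ℝ^d → W`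
with `Π_n 0 = 0` (the map `g ∘ φ_n⁻¹` clamped to the closed cube `‖u‖ ≤ δ_n`), continuous units
`A_{n,i} ≠ 0`, `J_n > 0`, continuous weights `wt_n ≥ 0` with `wt_n 0 > 0` — such that
`F_i (Π_n u) = A_{n,i}(u) u^{k_{n,i}}` for `‖u‖ ≤ δ_n` and, for every bounded measurable `G`
vanishing off the open cube `‖z‖ < r`,
`∫ G = ∑_n ∫_{‖u‖ < δ_n} G(Π_n u) wt_n(u) J_n(u) ∏_j |u_j|^{h_{n,j}} du`.
[cite: ArnoldGuseinzadeVarchenko2012, Part II §7.3, proof of Thm. 7.5]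
[cite: Lin2017, proof of Lemma 2.4] [cite: WatanabeSumio2009, Thm. 2.8] -/
theorem exists_chartSum {l : ℕ} {V W : Set (Fin d → ℝ)} {F : Fin l → (Fin d → ℝ) → ℝ}
    (hV : IsOpen V) (hVc : IsPreconnected V) (hF : ∀ i, AnalyticOnNhd ℝ (F i) V)
    (hFne : ∀ i, ∃ v ∈ V, F i v ≠ 0) (i₀ : Fin l) (hF0 : F i₀ 0 = 0)
    {M : Type} [TopologicalSpace M] [T2Space M] [ChartedSpace (Fin d → ℝ) M]
    [IsManifold 𝓘(ℝ, Fin d → ℝ) ω M] {g : M → (Fin d → ℝ)}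
    (hW : IsOpen W) (h0W : (0 : Fin d → ℝ) ∈ W) (hWV : W ⊆ V) (hgW : ∀ p, g p ∈ W)
    (hg : ContMDiff 𝓘(ℝ, Fin d → ℝ) 𝓘(ℝ, Fin d → ℝ) ω g)
    (hprop : ∀ K ⊆ W, IsCompact K → IsCompact (g ⁻¹' K))
    (hbij : BijOn g {p | ∀ i, F i (g p) ≠ 0} {x ∈ W | ∀ i, F i x ≠ 0})
    (hchart : ∀ p : M, (∃ i, F i (g p) = 0) →
      ∃ φ : OpenPartialHomeomorph M (Fin d → ℝ),
        φ ∈ IsManifold.maximalAtlas 𝓘(ℝ, Fin d → ℝ) ω M ∧ p ∈ φ.source ∧ φ p = 0 ∧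
        ∃ (k : Fin l → Fin d → ℕ) (h : Fin d → ℕ) (a : Fin l → (Fin d → ℝ) → ℝ)
          (b : (Fin d → ℝ) → ℝ),
          (∀ i, AnalyticOnNhd ℝ (a i) φ.target) ∧ AnalyticOnNhd ℝ b φ.target ∧
          (∀ i, ∀ u ∈ φ.target, a i u ≠ 0) ∧ (∀ u ∈ φ.target, b u ≠ 0) ∧
          (∀ i, ∀ u ∈ φ.target, F i (g (φ.symm u)) = a i u * ∏ j, u j ^ k i j) ∧
          (∀ u ∈ φ.target, (fderiv ℝ (g ∘ φ.symm) u).det = b u * ∏ j, u j ^ h j)) :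
    ∃ r : ℝ, 0 < r ∧ closedBall (0 : Fin d → ℝ) r ⊆ W ∧
      ∃ (ι : Type) (_ : Fintype ι) (δ : ι → ℝ) (Pm : ι → (Fin d → ℝ) → (Fin d → ℝ))
        (k : ι → Fin l → Fin d → ℕ) (h : ι → Fin d → ℕ) (A : ι → Fin l → (Fin d → ℝ) → ℝ)
        (J wt : ι → (Fin d → ℝ) → ℝ),
        (∀ n, 0 < δ n) ∧ (∀ n, Continuous (Pm n)) ∧ (∀ n, Pm n 0 = 0) ∧ (∀ n u, Pm n u ∈ W) ∧
        (∀ n i, Continuous (A n i)) ∧ (∀ n i u, A n i u ≠ 0) ∧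
        (∀ n, Continuous (J n)) ∧ (∀ n u, 0 < J n u) ∧
        (∀ n, Continuous (wt n)) ∧ (∀ n u, 0 ≤ wt n u) ∧ (∀ n, 0 < wt n 0) ∧
        (∀ n i u, ‖u‖ ≤ δ n → F i (Pm n u) = A n i u * ∏ j, u j ^ k n i j) ∧
        ∀ G : (Fin d → ℝ) → ℝ, Measurable G → (∃ C, ∀ z, |G z| ≤ C) →
          (∀ z, G z ≠ 0 → ‖z‖ < r) →
          ∫ z, G z = ∑ n, ∫ u in ball (0 : Fin d → ℝ) (δ n),
            G (Pm n u) * (wt n u * (J n u * ∏ j, |u j| ^ h n j)) := by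
  classical
  -- Step 1: total chart data (junk off the fibre)
  have key : ∀ p : M, ∃ (φ : OpenPartialHomeomorph M (Fin d → ℝ)) (δ : ℝ) (k : Fin l → Fin d → ℕ)
      (h : Fin d → ℕ) (a : Fin l → (Fin d → ℝ) → ℝ) (b : (Fin d → ℝ) → ℝ), g p = 0 →
      φ ∈ IsManifold.maximalAtlas 𝓘(ℝ, Fin d → ℝ) ω M ∧ p ∈ φ.source ∧ φ p = 0 ∧ 0 < δ ∧
        closedBall (0 : Fin d → ℝ) δ ⊆ φ.target ∧ (∀ i, ContinuousOn (a i) φ.target) ∧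
        ContinuousOn b φ.target ∧ (∀ i, ∀ u ∈ φ.target, a i u ≠ 0) ∧
        (∀ u ∈ φ.target, b u ≠ 0) ∧
        (∀ i, ∀ u ∈ φ.target, F i (g (φ.symm u)) = a i u * ∏ j, u j ^ k i j) ∧
        (∀ u ∈ φ.target, (fderiv ℝ (g ∘ φ.symm) u).det = b u * ∏ j, u j ^ h j) := by
    intro p
    by_cases hp : g p = 0
    · obtain ⟨φ, hφ, hps, hp0, k, h, a, b, ha, hb, ha0, hb0, hFa, hdet⟩ :=
        hchart p ⟨i₀, by rw [hp]; exact hF0⟩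
      have h0t : (0 : Fin d → ℝ) ∈ φ.target := by rw [← hp0]; exact φ.map_source hps
      obtain ⟨ε, hε, hεt⟩ := Metric.isOpen_iff.1 φ.open_target 0 h0t
      exact ⟨φ, ε / 2, k, h, a, b, fun _ => ⟨hφ, hps, hp0, half_pos hε,
        (closedBall_subset_ball (half_lt_self hε)).trans hεt, fun i => (ha i).continuousOn,
        hb.continuousOn, ha0, hb0, hFa, hdet⟩⟩
    · exact ⟨chartAt (Fin d → ℝ) p, 1, 0, 0, 0, 0, fun h0 => (hp h0).elim⟩
  choose φ δ k h a b hdata using key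
  -- Step 2: the weights along the fibre
  obtain ⟨s, r, wM, hs0, hr, hrW, hwMc, hwM0, hwMpos, hwMsupp, hwMsum⟩ :=
    exists_weights g hg.continuous hW h0W hprop φ δ (fun p hp => (hdata p hp).2.2.2.1)
      (fun p hp => (hdata p hp).2.1) (fun p hp => (hdata p hp).2.2.1)
      (fun p hp => (hdata p hp).2.2.2.2.1)
  -- Step 3: per-chart data for the chosen fibre points
  have hD : ∀ n : ↥s, _ := fun n : ↥s => hdata n (hs0 n n.2)
  have hδ : ∀ n : ↥s, 0 < δ n := fun n => (hD n).2.2.2.1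
  have htgt : ∀ n : ↥s, closedBall (0 : Fin d → ℝ) (δ n) ⊆ (φ n).target :=
    fun n => (hD n).2.2.2.2.1
  have hsrc : ∀ n : ↥s, (n : M) ∈ (φ n).source := fun n => (hD n).2.1
  have hsymm0 : ∀ n : ↥s, (φ n).symm 0 = n := fun n => by
    rw [← (hD n).2.2.1]; exact (φ n).left_inv (hsrc n)
  choose cl hclc hclball hclid hcl0 using fun n : ↥s => exists_clamp (d := d) (hδ n)
  have hcltgt : ∀ (n : ↥s) u, cl n u ∈ (φ n).target :=
    fun n u => htgt n (mem_closedBall_zero_iff.2 (hclball n u))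
  have hclball' : ∀ (n : ↥s), ∀ u ∈ ball (0 : Fin d → ℝ) (δ n), cl n u = u :=
    fun n u hu => hclid n u (mem_ball_zero_iff.1 hu).le
  have hPan : ∀ n : ↥s, AnalyticOnNhd ℝ (g ∘ (φ n).symm) (φ n).target :=
    fun n => analyticOnNhd_comp_symm hg (hD n).1
  have hPc : ∀ n : ↥s, ContinuousOn (g ∘ (φ n).symm) (φ n).target :=
    fun n => hg.continuous.comp_continuousOn (φ n).continuousOn_symm
  -- the clamped chart maps, units, Jacobian units and weights
  set Pm : ↥s → (Fin d → ℝ) → (Fin d → ℝ) := fun n u => g ((φ n).symm (cl n u)) with hPm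
  set A : ↥s → Fin l → (Fin d → ℝ) → ℝ := fun n i u => a n i (cl n u) with hA
  set J : ↥s → (Fin d → ℝ) → ℝ := fun n u => |b n (cl n u)| with hJ
  set wt : ↥s → (Fin d → ℝ) → ℝ := fun n u => wM n ((φ n).symm (cl n u)) with hwt
  have hPmc : ∀ n, Continuous (Pm n) := fun n => (hPc n).comp_continuous (hclc n) (hcltgt n)
  have hPm0 : ∀ n, Pm n 0 = 0 := fun n => by
    simp only [hPm, hcl0, hsymm0]; exact hs0 n n.2
  have hAc : ∀ n i, Continuous (A n i) := fun n i =>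
    ((hD n).2.2.2.2.2.1 i).comp_continuous (hclc n) (hcltgt n)
  have hA0 : ∀ n i u, A n i u ≠ 0 := fun n i u => (hD n).2.2.2.2.2.2.2.1 i _ (hcltgt n u)
  have hJc : ∀ n, Continuous (J n) := fun n =>
    continuous_abs.comp ((hD n).2.2.2.2.2.2.1.comp_continuous (hclc n) (hcltgt n))
  have hJpos : ∀ n u, 0 < J n u := fun n u => abs_pos.2 ((hD n).2.2.2.2.2.2.2.2.1 _ (hcltgt n u))
  have hwtc : ∀ n, Continuous (wt n) := fun n =>
    (hwMc n n.2).comp (((φ n).continuousOn_symm).comp_continuous (hclc n) (hcltgt n))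
  have hwt0 : ∀ n u, 0 ≤ wt n u := fun n u => hwM0 n n.2 _
  have hwtpos : ∀ n, 0 < wt n 0 := fun n => by
    simp only [hwt, hcl0, hsymm0]; exact hwMpos n n.2
  have hmono : ∀ (n : ↥s) i u, ‖u‖ ≤ δ n → F i (Pm n u) = A n i u * ∏ j, u j ^ k n i j := by
    intro n i u hu
    simp only [hPm, hA, hclid n u hu]
    exact (hD n).2.2.2.2.2.2.2.2.2.1 i u (htgt n (mem_closedBall_zero_iff.2 hu))
  refine ⟨r, hr, hrW, ↥s, inferInstance, fun n => δ n, Pm, fun n => k n, fun n => h n, A, J, wt,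
    hδ, hPmc, hPm0, fun n u => hgW _, hAc, hA0, hJc, hJpos, hwtc, hwt0, hwtpos, hmono, ?_⟩
  -- Step 4: the integral identity
  rintro G hGm ⟨C, hGC⟩ hGsupp
  have hrV : ball (0 : Fin d → ℝ) r ⊆ V := (ball_subset_closedBall.trans hrW).trans hWV
  -- the zero sets are null
  have hZ : volume {x ∈ V | ∃ i, F i x = 0} = 0 := by
    have : {x ∈ V | ∃ i, F i x = 0} = ⋃ i, {x ∈ V | F i x = 0} := by
      ext x; simp only [mem_setOf_eq, mem_iUnion]; 
      exact ⟨fun ⟨hx, i, hi⟩ => ⟨i, hx, hi⟩, fun ⟨i, hx, hi⟩ => ⟨hx, i, hi⟩⟩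
    rw [this]
    exact measure_iUnion_null fun i =>
      Mityagin2015.volume_zeroSet_null_pi hV hVc (hF i) (hFne i)
  -- the good open set
  set S : Set (Fin d → ℝ) := ball 0 r ∩ {x | ∀ i, F i x ≠ 0} with hS
  have hSo : IsOpen S := by
    rw [isOpen_iff_mem_nhds]
    rintro x ⟨hxb, hxF⟩
    refine inter_mem (isOpen_ball.mem_nhds hxb) ?_
    have : {x : Fin d → ℝ | ∀ i, F i x ≠ 0} = ⋂ i, {x | F i x ≠ 0} := by ext; simp
    rw [this, Filter.iInter_mem]
    intro i
    exact ((hF i x (hrV hxb)).continuousAt).preimage_mem_nhds (isOpen_ne.mem_nhds (hxF i))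
  have hSW : ∀ z ∈ S, z ∈ W ∧ ∀ i, F i z ≠ 0 :=
    fun z hz => ⟨hrW (ball_subset_closedBall hz.1), hz.2⟩
  -- (A) `∫ G = ∫_S G`
  have hAe : ∫ z, G z = ∫ z in S, G z := by
    refine (setIntegral_eq_integral_of_ae_compl_eq_zero ?_).symm
    filter_upwards [measure_eq_zero_iff_ae_notMem.1 hZ] with z hzZ hzS
    by_contra hGz
    have hzb : z ∈ ball (0 : Fin d → ℝ) r := mem_ball_zero_iff.2 (hGsupp z hGz)
    refine hzS ⟨hzb, fun i hi => hzZ ⟨hrV hzb, i, hi⟩⟩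
  -- (B) per-chart change of variables
  set T : ↥s → Set (Fin d → ℝ) := fun n => ball 0 (δ n) ∩ Pm n ⁻¹' S with hT
  have hTS : ∀ n, Pm n '' T n ⊆ S := by
    rintro n _ ⟨u, hu, rfl⟩; exact hu.2
  have hgood : ∀ n, ∀ u ∈ T n, (φ n).symm u ∈ {p : M | ∀ i, F i (g p) ≠ 0} := by
    rintro n u ⟨hub, huS⟩
    have : Pm n u = g ((φ n).symm u) := by simp only [hPm, hclball' n u hub]
    show ∀ i, F i (g ((φ n).symm u)) ≠ 0
    rw [← this]; exact (hSW _ huS).2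
  have hinj : ∀ n, InjOn (Pm n) (T n) := by
    intro n u hu v hv huv
    have hu' : Pm n u = g ((φ n).symm u) := by simp only [hPm, hclball' n u hu.1]
    have hv' : Pm n v = g ((φ n).symm v) := by simp only [hPm, hclball' n v hv.1]
    rw [hu', hv'] at huv
    have heq : (φ n).symm u = (φ n).symm v := hbij.injOn (hgood n u hu) (hgood n v hv) huv
    have hut : u ∈ (φ n).target := htgt n (ball_subset_closedBall hu.1)
    have hvt : v ∈ (φ n).target := htgt n (ball_subset_closedBall hv.1)
    rw [← (φ n).right_inv hut, ← (φ n).right_inv hvt, heq]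
  have hdet : ∀ n : ↥s, ∀ u ∈ ball (0 : Fin d → ℝ) (δ n),
      |(fderiv ℝ (g ∘ (φ n).symm) u).det| = J n u * ∏ j, |u j| ^ h n j := by
    intro n u hu
    rw [(hD n).2.2.2.2.2.2.2.2.2.2 u (htgt n (ball_subset_closedBall hu)), abs_mul,
      Finset.abs_prod]
    simp only [hJ, hclball' n u hu, abs_pow]
  have hchartCV := fun n : ↥s =>
    setIntegral_image_chart (hPan n) (htgt n) (fun u hu => by simp only [hPm, hclball' n u hu]; rfl)
      (hPmc n) hSo (hinj n) (hJc n) (hdet n) hGm hGC (hwtc n)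
  -- (C) pointwise decomposition of `G` on `S`
  have hpt : ∀ z ∈ S, G z = ∑ n : ↥s,
      (Pm n '' T n).indicator (fun z => G z * wt n (invFunOn (Pm n) (T n) z)) z := by
    intro z hz
    obtain ⟨p, hp, hpz⟩ := hbij.surjOn (hSW z hz)
    have hsum1 : ∑ q ∈ s, wM q p = 1 :=
      hwMsum p (by rw [hpz]; exact (mem_ball_zero_iff.1 hz.1).le)
    have hval : ∀ n : ↥s,
        (Pm n '' T n).indicator (fun z => G z * wt n (invFunOn (Pm n) (T n) z)) z =
          G z * wM n p := by
      intro n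
      by_cases hzn : z ∈ Pm n '' T n
      · rw [indicator_of_mem hzn]
        obtain ⟨u, hu, rfl⟩ := hzn
        rw [(hinj n).leftInvOn_invFunOn hu]
        simp only [hwt, hclball' n u hu.1]
        congr 2
        refine hbij.injOn (hgood n u hu) hp ?_
        rw [hpz]; simp only [hPm, hclball' n u hu.1]
      · rw [indicator_of_notMem hzn]
        by_contra hne
        have hne' : wM n p ≠ 0 := by
          intro h0; exact hne (by rw [h0, mul_zero])
        obtain ⟨hps, hpn⟩ := hwMsupp n n.2 p hne'
        have hub : (φ n) p ∈ ball (0 : Fin d → ℝ) (δ n) := mem_ball_zero_iff.2 hpn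
        have hPu : Pm n ((φ n) p) = z := by
          simp only [hPm, hclball' n _ hub, (φ n).left_inv hps]; exact hpz
        exact hzn ⟨(φ n) p, ⟨hub, by show Pm n ((φ n) p) ∈ S; rw [hPu]; exact hz⟩, hPu⟩
    rw [Finset.sum_congr rfl fun n _ => hval n, ← Finset.mul_sum, Finset.sum_coe_sort s
      (fun q => wM q p), hsum1, mul_one]
  -- (D) summation
  have hint : ∀ n : ↥s, Integrable
      ((Pm n '' T n).indicator (fun z => G z * wt n (invFunOn (Pm n) (T n) z)))
      (volume.restrict S) := by
    intro n
    rw [integrable_indicator_iff (hchartCV n).1, IntegrableOn,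
      Measure.restrict_restrict (hchartCV n).1, inter_eq_left.2 (hTS n)]
    exact (hchartCV n).2.1
  calc ∫ z, G z = ∫ z in S, G z := hAe
    _ = ∫ z in S, ∑ n : ↥s,
          (Pm n '' T n).indicator (fun z => G z * wt n (invFunOn (Pm n) (T n) z)) z :=
        setIntegral_congr_fun hSo.measurableSet hpt
    _ = ∑ n : ↥s, ∫ z in S,
          (Pm n '' T n).indicator (fun z => G z * wt n (invFunOn (Pm n) (T n) z)) z :=
        integral_finsetSum _ fun n _ => hint n
    _ = ∑ n : ↥s, ∫ u in T n, G (Pm n u) * (wt n u * (J n u * ∏ j, |u j| ^ h n j)) := by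
        refine Finset.sum_congr rfl fun n _ => ?_
        rw [setIntegral_indicator (hchartCV n).1, inter_eq_right.2 (hTS n)]
        exact (hchartCV n).2.2
    _ = ∑ n : ↥s, ∫ u in ball (0 : Fin d → ℝ) (δ n),
          G (Pm n u) * (wt n u * (J n u * ∏ j, |u j| ^ h n j)) := by
        refine Finset.sum_congr rfl fun n _ => ?_
        refine (setIntegral_eq_of_zero_off_hyperplanes isOpen_ball.measurableSet
          inter_subset_left fun u hu hX => ?_).symm
        obtain ⟨hub, huT⟩ := hu
        have hG0 : G (Pm n u) ≠ 0 := fun h0 => hX (by rw [h0, zero_mul])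
        have hzb : Pm n u ∈ ball (0 : Fin d → ℝ) r := mem_ball_zero_iff.2 (hGsupp _ hG0)
        have hnS : Pm n u ∉ S := fun h' => huT ⟨hub, h'⟩
        have hex : ∃ i, F i (Pm n u) = 0 := by
          by_contra hall; push Not at hall; exact hnS ⟨hzb, hall⟩
        obtain ⟨i, hi⟩ := hex
        rw [hmono n i u (mem_ball_zero_iff.1 hub).le] at hi
        rcases mul_eq_zero.1 hi with h0 | h0
        · exact (hA0 n i u h0).elim
        · obtain ⟨j, -, hj⟩ := Finset.prod_eq_zero_iff.1 h0
          exact ⟨j, (pow_eq_zero_iff'.1 hj).1⟩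

end Resolution

end Literature.Analysis.Calculus

end
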